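import Summits.CriticalPhenomena.CardyFormulaZ2.Theorems.CardyBoundaryCoulombGasBoundaryDefectGaussianRStubRealisabilityPart45

/-!
# Stub `stub_realisability` of line `rainbow-monomials-in-excursion-kernels` — Part 46:
# Lemma V (unit height differences at every tracked corner of the jump collar) — assembly
# (crux `BoundaryDefectGaussianR`, stmt-CriticalPhenomena-14132; insertion dictionary D2)

**Theorem** (`unitDifferences_tracked`, registered as `s13_unitDifferences_tracked`; live-edge
corollary `unitDifferences_live` = `s13_unitDifferences`, the hypothesis `hunit` of the BKW
factorisation). Let `ι` be ADMISSIBLE on `V`, its insertion points FLAT to distance `sinkLegs + 4`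
(`V` a discrete half-plane there; the clause of `s16_eventually_flat` with `3 ↦ 4`), and let every
boundary vertex of `V` have a `√8`-CHART (Part 42; the registered forms take the `7 × 7` sup-norm
charts of `s16_eventually_chart` and convert by `chart8_of_chart3`, Part 44). Then every valid
height configuration `h` of `ι.model V` satisfies `|h x - h f| = 1` for every vertex-cell `x` and
every face-cell `f` at `x`.

Proof (`pcc_of_charts`). Validity covers corners with a free cell (Part 41). For a prescribed
vertex-cell `x` (arc vertex / ghost) and a collar face `f` at it, the WINDOW of the corner (Part 45;
`window_of_prescribed`) is four consecutive darts `c₀ … c₃` with `f` the gap face of `c₀`, `c₁` or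
`c₂` — met on a FREE stretch, `f` being no pocket — and a WIRED state among the five states around
the window (the arc / the pocket that makes `x` prescribed); so the wiredness flips at some `cₘ`
(`bool_window_flip`), an ACTIVE dart; active darts lie in footprints, around which flatness makes
the boundary a straight strip covering the window (Part 44, `strip_of_active`); on the strip the two
cells read their levels at the two ends of one junction (Part 43, `strip_pair`): `|Δ| = 1`.

**Both hypotheses are necessary** (exact evaluation of the definitions, this seat; `L = sinkLegs`):
* charts: `V = [0,12]×[0,6] ∪ {(13..16, 3)} ∪ [17,31]×[0,6]` (lattice-connected, complement
  king-connected, a width-one neck), sources `(23,0),(24,0),(25,0)` with one leg each, sink `(6,0)`: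
  admissible, flat to distance `6 = L + 3` at all four points, and the valid configuration "free
  vertices `-1`, free faces `-2`" exists; yet the neck vertices are arc vertices at `vertH = -3`
  (wired return stretch above) over collar faces at `faceH = 0` (free outgoing stretch below):
  `|Δ| = 3` at the live edges `((13,3),E) … ((16,3),E)` (8 live-edge corners, 18 tracked ones; the
  ghosts `(13..16, 2)` below the neck are never mentioned, `vertH = 0 = faceH`).
* flatness: box `[0,12]×[0,6]`, source `(11,0)` with `5` legs, sink `(3,6)` (charts everywhere, the
  source one step from the corner): the footprint `jump, jump, junction` turns the corner `(12,0)`,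
  an arc vertex at `-5` next to the collar face `(11,-1)` at `-2`: `|Δ| = 3`.

Unit tests of the conclusion (exact evaluation; all tracked prescribed pairs `(x, f)` as `vertH ∣ faceH`,
`|Δ| = 1` in every case): `4×2` box, sink `(2,0)`: `(1;1)`: `((1,0),(0,-1))`: `-1 ∣ 0`, `((2,0),(2,-1))`: `-1 ∣ 0`,
ghosts `(1,-1),(2,-1)` at `-1` against `(0,-1),(2,-1)` at `0`; `(1,1;2)` (sources `(1,0),(2,1)`):
`((1,0),(1,-1))`: `-1 ∣ -2`, `((2,1),(2,1))`: `-1 ∣ 0` (+ 2 ghost pairs); `(1,1,1;3)` (sources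
`(1,0),(1,1),(2,1)`): `((1,0),(0,-1))`: `-3 ∣ -2`, `((1,1),(0,1))`: `-1 ∣ -2`, `((2,0),(2,-1))`: `-3 ∣ -2`,
`((2,1),(2,1))`: `-1 ∣ 0` (+ 4 ghost pairs); `(2;2)`, `6×2` box `(2,2;4)`: no prescribed pairs (no arc);
`20×10` box `(1;1)` / `(2;2)` with points `≥ 5` from the corners: all hypotheses hold, 4 / 0 pairs;
L-shape `[0,30]×[0,9] ∪ [0,9]×[0,24]` with `(1,2;3)`, `(1,1,1;3)` (arcs through the reflex and the
convex corners): 4 / 8 pairs, all `|Δ| = 1`.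
-/

namespace Summit.CriticalPhenomena.CardyFormulaZ2.Cruxes.BoundaryDefectGaussianR.RainbowMonomialsInExcursionKernels

open Literature.Probability.LatticeModels Literature.Probability.LatticeModels.CollarLegModel

/-- The four elements of `Fin 4` (file-local copy). [folklore] -/
private theorem fin4_cases (i : Fin 4) : i = 0 ∨ i = 1 ∨ i = 2 ∨ i = 3 := by fin_cases i <;> simp

/-- Every direction is `k + i` for some `i` (file-local copy). [folklore] -/
private theorem fin4_exists_add (k j : Fin 4) : ∃ i : Fin 4, j = k + i := ⟨j - k, by revert j k; decide⟩

section Assembly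

variable (ι : LegInsertionData) (V : Finset (ℤ × ℤ)) {d₀ : Dart} (hadm : ι.IsAdmissible V)
  (h0 : outDart V ι.sink = some d₀) {st : ℕ → WalkState}
  (hst : ∀ t, st t = List.foldl (fun s d => s.step (ι.startAt V d)) ι.init ((cycle V d₀).take t))
  (hCH : ∀ x ∈ V, (∃ y : ℤ × ℤ, y ∉ V ∧ (y.1 - x.1) ^ 2 + (y.2 - x.2) ^ 2 = 1) →
    ∃ a d : ℤ × ℤ, (d = (1, 0) ∨ d = (-1, 0) ∨ d = (0, 1) ∨ d = (0, -1)) ∧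
    ((∀ v : ℤ × ℤ, (v.1 - x.1) ^ 2 + (v.2 - x.2) ^ 2 ≤ 8 →
        (v ∈ V ↔ 0 ≤ (v.1 - a.1) * d.1 + (v.2 - a.2) * d.2)) ∨
     (∀ v : ℤ × ℤ, (v.1 - x.1) ^ 2 + (v.2 - x.2) ^ 2 ≤ 8 →
        (v ∈ V ↔ 0 ≤ (v.1 - a.1) * d.1 + (v.2 - a.2) * d.2 ∧ 0 ≤ (v.2 - a.2) * d.1 - (v.1 - a.1) * d.2)) ∨
     (∀ v : ℤ × ℤ, (v.1 - x.1) ^ 2 + (v.2 - x.2) ^ 2 ≤ 8 →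
        (v ∈ V ↔ 0 ≤ (v.1 - a.1) * d.1 + (v.2 - a.2) * d.2 ∨ 0 ≤ (v.2 - a.2) * d.1 - (v.1 - a.1) * d.2))))

include hadm h0 hCH in
/-- An exterior dart at a vertex met by the cycle is itself a cycle dart. [folklore] -/
theorem on_cycle_of_exterior_at {t : ℕ} {y : ℤ × ℤ} {k j : Fin 4} (ht : t < (cycle V d₀).length)
    (hyt : (cycle V d₀)[t] = (y, k)) (hj : y + dir j ∉ V) :
    ∃ s, ∃ hs : s < (cycle V d₀).length, (cycle V d₀)[s] = (y, j) := by
  obtain ⟨hv₀, ht₀⟩ := sinkDart_exterior ι V hadm h0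
  have hP : 0 < (cycle V d₀).length := by omega
  have hy : y ∈ V := by have := (cycle_getElem_exterior ι V hadm h0 ht).1; rwa [hyt] at this
  have hk : y + dir k ∉ V := by have := (cycle_getElem_exterior ι V hadm h0 ht).2; rwa [hyt] at this
  obtain ⟨L1, -⟩ := chart_at hCH hy hk
  obtain ⟨i, rfl⟩ := fin4_exists_add k j
  rcases fin4_cases i with rfl | rfl | rfl | rfl
  · exact ⟨t, ht, by rw [hyt, add_zero]⟩
  · refine ⟨(t + 1) % (cycle V d₀).length, Nat.mod_lt _ hP, ?_⟩
    rw [cycle_succ hv₀ ht₀ ht, hyt, dsucc_turn hj]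
  · exact absurd L1 (nmem_of_eq hj (by rw [tp_dir_add_two]; abel))
  · have hs3 : dsucc V (y, k + 3) = (cycle V d₀)[t] := by
      rw [hyt, dsucc_turn (by rw [fin4_add_three_add_one]; exact hk), fin4_add_three_add_one]
    obtain ⟨s, hs, -, hds⟩ := cycle_pred_of_dsucc hv₀ ht₀ (e := (y, k + 3)) hy (by rw [dartTip_mk]; exact hj) ht hs3
    exact ⟨s, hs, hds⟩

include hadm h0 hst in
/-- Bookkeeping: a wired stretch touching a dart of the window `c₀ … c₃` is one of the five states
around the window. [folklore] -/
theorem wired_of_mem_window {c₀ s : ℕ} (hc₀ : c₀ < (cycle V d₀).length) (hs : s < (cycle V d₀).length)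
    (hmem : s = c₀ ∨ s = (c₀ + 1) % (cycle V d₀).length ∨ s = ((c₀ + 1) % (cycle V d₀).length + 1) % (cycle V d₀).length ∨
      s = (((c₀ + 1) % (cycle V d₀).length + 1) % (cycle V d₀).length + 1) % (cycle V d₀).length)
    (hw : (st s).wired = true ∨ (st (s + 1)).wired = true) :
    (st c₀).wired = true ∨ (st ((c₀ + 1) % (cycle V d₀).length)).wired = true ∨
      (st (((c₀ + 1) % (cycle V d₀).length + 1) % (cycle V d₀).length)).wired = true ∨
      (st ((((c₀ + 1) % (cycle V d₀).length + 1) % (cycle V d₀).length + 1) % (cycle V d₀).length)).wired = true ∨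
      (st ((((c₀ + 1) % (cycle V d₀).length + 1) % (cycle V d₀).length + 1) % (cycle V d₀).length + 1)).wired = true := by
  have hP : 0 < (cycle V d₀).length := by omega
  rcases hmem with rfl | rfl | rfl | rfl
  · rcases hw with hw | hw
    · exact Or.inl hw
    · right; left; rw [(st_mod_succ ι V hadm h0 hst hs).2]; exact hw
  · rcases hw with hw | hw
    · exact Or.inr (Or.inl hw)
    · right; right; left; rw [(st_mod_succ ι V hadm h0 hst hs).2]; exact hw
  · rcases hw with hw | hw
    · exact Or.inr (Or.inr (Or.inl hw))
    · right; right; right; left; rw [(st_mod_succ ι V hadm h0 hst hs).2]; exact hw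
  · rcases hw with hw | hw
    · exact Or.inr (Or.inr (Or.inr (Or.inl hw)))
    · exact Or.inr (Or.inr (Or.inr (Or.inr hw)))

include hadm h0 hst hCH in
/-- **The window of a prescribed corner.** For a prescribed vertex-cell `x` (arc vertex or ghost)
of the jump collar and a face-cell `f` at `x` that is neither interior nor a pocket, there is a
window of four consecutive darts `c₀ … c₃` such that `f` is the gap face of `c₀`, `c₁` or `c₂` and
one of the five walk states around the window is wired. [folklore] -/
theorem window_of_prescribed {x f : ℤ × ℤ} (hx : x ∈ (ι.model V).vertexCells) (hxf : (x, false) ∉ (ι.model V).freeCells)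
    (hf : f ∈ SixVertex.vertexFaces x) (hfc : f ∈ (ι.model V).faceCells) (hff : (f, true) ∉ (ι.model V).freeCells) :
    ∃ c₀, ∃ hc₀ : c₀ < (cycle V d₀).length,
      (f = gapFace (cycle V d₀)[c₀] ∨
        f = gapFace ((cycle V d₀)[(c₀ + 1) % (cycle V d₀).length]'(Nat.mod_lt _ (by omega))) ∨
        f = gapFace ((cycle V d₀)[((c₀ + 1) % (cycle V d₀).length + 1) % (cycle V d₀).length]'(Nat.mod_lt _ (by omega)))) ∧
      ((st c₀).wired = true ∨ (st ((c₀ + 1) % (cycle V d₀).length)).wired = true ∨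
        (st (((c₀ + 1) % (cycle V d₀).length + 1) % (cycle V d₀).length)).wired = true ∨
        (st ((((c₀ + 1) % (cycle V d₀).length + 1) % (cycle V d₀).length + 1) % (cycle V d₀).length)).wired = true ∨
        (st ((((c₀ + 1) % (cycle V d₀).length + 1) % (cycle V d₀).length + 1) % (cycle V d₀).length + 1)).wired = true) := by
  obtain ⟨hv₀, ht₀⟩ := sinkDart_exterior ι V hadm h0
  have hP : 0 < (cycle V d₀).length := length_cycle_pos ι V hadm h0
  obtain ⟨hni, hnp⟩ := not_mem_of_not_mem_freeCells (ι.model V) hff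
  have hfV : f ∈ SixVertex.faces V := hfc
  rcases mem_arc_or_ghosts_of_not_mem_freeCells (ι.model V) hx hxf with ⟨-, harc⟩ | ⟨hxV, hg⟩
  · -- an arc vertex
    obtain ⟨t, ht, hw, hxt⟩ := (mem_collar_arc_iff ι V h0 hst).1 harc
    obtain ⟨⟨y, k⟩, hyt⟩ : ∃ q : Dart, (cycle V d₀)[t] = q := ⟨_, rfl⟩
    have hyx : y = x := by rw [hyt] at hxt; exact hxt
    subst hyx
    obtain ⟨c₀, hc₀, hfaces, hdarts⟩ := window_vertex hCH hv₀ ht₀ ht hyt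
    exact ⟨c₀, hc₀, hfaces f hf hni, wired_of_mem_window ι V hadm h0 hst hc₀ ht (hdarts t ht hxt) hw⟩
  · -- a ghost
    change x ∉ V at hxV
    have hg' := (Finset.mem_sdiff.mp hg).1
    rcases Finset.mem_union.mp hg' with h1 | h2
    · -- … adjacent to an arc vertex `y`
      obtain ⟨y, hy, hxy⟩ := Finset.mem_biUnion.mp h1
      obtain ⟨hyarc, hyV⟩ := Finset.mem_inter.mp hy
      obtain ⟨t, ht, hw, hyt'⟩ := (mem_collar_arc_iff ι V h0 hst).1 hyarc
      obtain ⟨⟨y', k'⟩, hyt⟩ : ∃ q : Dart, (cycle V d₀)[t] = q := ⟨_, rfl⟩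
      have hyy : y' = y := by rw [hyt] at hyt'; exact hyt'
      subst hyy
      obtain ⟨j, rfl⟩ := mem_neighbours_iff.mp hxy
      obtain ⟨s, hs, hys⟩ := on_cycle_of_exterior_at ι V hadm h0 hCH ht hyt hxV
      obtain ⟨c₀, hc₀, hfaces, hnbrs, -⟩ := window_ghost hCH hv₀ ht₀ hs hys
      exact ⟨c₀, hc₀, hfaces f hf hfV, wired_of_mem_window ι V hadm h0 hst hc₀ ht (hnbrs y' hyV hxy t ht hyt') hw⟩
    · -- … or an outside corner of a pocket
      obtain ⟨p, hp, hxp⟩ := Finset.mem_biUnion.mp h2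
      obtain ⟨hpC, hpb⟩ := Finset.mem_inter.mp hp
      obtain ⟨s0, hs0, hw0, hg0⟩ := (mem_collar_pocket_iff ι V h0 hst).1 hpC
      obtain ⟨⟨y, k⟩, hys⟩ : ∃ q : Dart, (cycle V d₀)[s0] = q := ⟨_, rfl⟩
      rw [hys] at hg0
      subst hg0
      have hy : y ∈ V := by have := (cycle_getElem_exterior ι V hadm h0 hs0).1; rwa [hys] at this
      have hk : y + dir k ∉ V := by have := (cycle_getElem_exterior ι V hadm h0 hs0).2; rwa [hys] at this
      have hw0' : (st s0).wired = true ∨ (st (s0 + 1)).wired = true := Or.inr hw0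
      rcases (mem_faceCorners_gapFace _ _ _).mp hxp with rfl | rfl | rfl | rfl
      · exact absurd hy hxV
      · -- the tip of the pocket's dart
        obtain ⟨c₀, hc₀, hfaces, hnbrs, -⟩ := window_ghost hCH hv₀ ht₀ hs0 hys
        exact ⟨c₀, hc₀, hfaces f hf hfV,
          wired_of_mem_window ι V hadm h0 hst hc₀ hs0 (hnbrs y hy (mem_neighbours_iff.mpr ⟨k, rfl⟩) s0 hs0 (by rw [hys])) hw0'⟩
      · -- the tip of the next dart (a convex corner at `y`)
        have hsucc : (cycle V d₀)[(s0 + 1) % (cycle V d₀).length]'(Nat.mod_lt _ hP) = (y, k + 1) := by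
          rw [cycle_succ hv₀ ht₀ hs0, hys, dsucc_turn hxV]
        obtain ⟨c₀, hc₀, hfaces, hnbrs, -⟩ := window_ghost hCH hv₀ ht₀ (Nat.mod_lt _ hP) hsucc
        exact ⟨c₀, hc₀, hfaces f hf hfV,
          wired_of_mem_window ι V hadm h0 hst hc₀ hs0 (hnbrs y hy (mem_neighbours_iff.mpr ⟨k + 1, rfl⟩) s0 hs0 (by rw [hys])) hw0'⟩
      · -- the diagonal corner
        by_cases hE : y + dir (k + 1) ∈ V
        · have hsucc : (cycle V d₀)[(s0 + 1) % (cycle V d₀).length]'(Nat.mod_lt _ hP) = (y + dir (k + 1), k) := by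
            rw [cycle_succ hv₀ ht₀ hs0, hys, dsucc_straight_rule hE (nmem_of_eq hxV (by abel))]
          obtain ⟨c₀, hc₀, hfaces, -, hpreds⟩ := window_ghost hCH hv₀ ht₀ (Nat.mod_lt _ hP) hsucc
          rw [add_right_comm] at hf
          refine ⟨c₀, hc₀, hfaces f hf hfV, ?_⟩
          have hmem := hpreds s0 hs0 (by rw [cycle_succ hv₀ ht₀ hs0])
          exact wired_of_mem_window ι V hadm h0 hst hc₀ hs0 (hmem.elim Or.inl fun h => Or.inr (Or.inl h)) hw0'
        · have := window_isolated hCH hy hk hE hf hfV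
          subst this
          exact absurd hp hnp


/-- Five consecutive booleans that are neither all true nor all false flip somewhere. [folklore] -/
theorem bool_window_flip : ∀ b0 b1 b2 b3 b4 : Bool,
    (b0 = true ∨ b1 = true ∨ b2 = true ∨ b3 = true ∨ b4 = true) → (b1 = false ∨ b2 = false ∨ b3 = false) →
    (b0 ≠ b1 ∨ b1 ≠ b2 ∨ b2 ≠ b3 ∨ b3 ≠ b4) := by
  decide

/-- Index bookkeeping: two steps. [folklore] -/
theorem mod_succ_succ {P c : ℕ} : ((c + 1) % P + 1) % P = (c + 2) % P := by
  rw [Nat.mod_add_mod]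

/-- Index bookkeeping: from position `m` of a window to position `fpos`. [folklore] -/
theorem window_offset {P c m fpos : ℕ} (hP : 0 < P) (hm : m ≤ 3) :
    ((c + m) % P + 4 * P - 4 + (4 + fpos - m)) % P = (c + fpos) % P := by
  rw [show (c + m) % P + 4 * P - 4 + (4 + fpos - m) = (c + m) % P + (4 * P - 4 + (4 + fpos - m)) by omega,
    Nat.mod_add_mod, show c + m + (4 * P - 4 + (4 + fpos - m)) = c + fpos + 4 * P by omega,
    Nat.add_mul_mod_self_right]

include hadm hCH in
/-- **The prescribed corner condition** for the jump collar of an admissible leg insertion whose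
insertion points are flat to distance `sinkLegs + 4`, on a domain with `√8`-charts at its boundary
vertices: every prescribed vertex-cell (arc vertex or ghost) and every prescribed face-cell (collar
face) at it carry levels differing by exactly one. Proof: the window of the corner (Part 16)
contains a free state (the collar face) and a wired one (the prescribed vertex-cell), hence a
junction; junctions lie in footprints, around which the boundary is a straight strip (Part 15), and
on a straight strip the two cells read their levels at the two ends of one junction (Part 13).
[folklore] -/
theorem pcc_of_charts
    (hFL : ∀ x ∈ insert ι.sink ι.source, ∃ d : ℤ × ℤ, (d = (1, 0) ∨ d = (-1, 0) ∨ d = (0, 1) ∨ d = (0, -1)) ∧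
      ∀ v : ℤ × ℤ, (v.1 - x.1) ^ 2 + (v.2 - x.2) ^ 2 ≤ ((ι.sinkLegs : ℤ) + 4) ^ 2 →
        (v ∈ V ↔ 0 ≤ (v.1 - x.1) * d.1 + (v.2 - x.2) * d.2)) :
    ∀ x ∈ (ι.model V).vertexCells, (x, false) ∉ (ι.model V).freeCells → ∀ f ∈ SixVertex.vertexFaces x,
      f ∈ (ι.model V).faceCells → (f, true) ∉ (ι.model V).freeCells →
      |(ι.model V).C.vertH x - (ι.model V).C.faceH f| = 1 := by
  obtain ⟨d₀, h0, -, hv₀, ht₀, -⟩ := s3_of_admissible ι V hadm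
  set st : ℕ → WalkState := fun t => List.foldl (fun s d => s.step (ι.startAt V d)) ι.init ((cycle V d₀).take t)
    with hst_def
  have hst : ∀ t, st t = List.foldl (fun s d => s.step (ι.startAt V d)) ι.init ((cycle V d₀).take t) := fun _ => rfl
  intro x hx hxf f hf hfc hff
  change |(ι.collar V).vertH x - (ι.collar V).faceH f| = 1
  set P := (cycle V d₀).length with hPdef
  have hP : 0 < P := length_cycle_pos ι V hadm h0
  obtain ⟨hni, hnp⟩ := not_mem_of_not_mem_freeCells (ι.model V) hff
  obtain ⟨c₀, hc₀, hface, hwired⟩ := window_of_prescribed ι V hadm h0 hst hCH hx hxf hf hfc hff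
  -- a collar face is met on a free stretch
  have hfree : ∀ c, ∀ hc : c < P, f = gapFace (cycle V d₀)[c] → (st (c + 1)).wired = false := by
    intro c hc hfc'
    by_contra hw
    have hw' : (st (c + 1)).wired = true := by simpa using hw
    have hpk : f ∈ (ι.collar V).pocket := (mem_collar_pocket_iff ι V h0 hst).2 ⟨c, hc, hw', hfc'.symm⟩
    have hex := cycle_getElem_exterior ι V hadm h0 hc
    have hbd : f ∈ SixVertex.bdryFaces V := by
      rw [hfc']; have := (gapFace_mem_bdryFaces hex.1 hex.2).1; rwa [Prod.mk.eta] at this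
    exact hnp (Finset.mem_inter.mpr ⟨hpk, hbd⟩)
  -- positions in the window, as offsets from `c₀`
  have i0 : c₀ = (c₀ + 0) % P := by rw [add_zero, Nat.mod_eq_of_lt hc₀]
  have i2 : ((c₀ + 1) % P + 1) % P = (c₀ + 2) % P := mod_succ_succ
  have i3 : (((c₀ + 1) % P + 1) % P + 1) % P = (c₀ + 3) % P := by rw [i2, Nat.mod_add_mod]
  have hfpos : ∃ fpos, fpos ≤ 2 ∧ f = gapFace ((cycle V d₀)[(c₀ + fpos) % P]'(Nat.mod_lt _ hP)) := by
    rcases hface with h | h | h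
    · exact ⟨0, by norm_num, by rw [h, getElem_cycle_congr hc₀ (Nat.mod_lt _ hP) i0]⟩
    · exact ⟨1, by norm_num, h⟩
    · exact ⟨2, by norm_num, by rw [h, getElem_cycle_congr (Nat.mod_lt _ hP) (Nat.mod_lt _ hP) i2]⟩
  obtain ⟨fpos, hfpos2, hfeq⟩ := hfpos
  -- the five states around the window: `w a` before dart `c₀ + a` (`a ≤ 3`), and after dart `c₀ + 3`
  have hAB : ∀ a : ℕ, (st ((c₀ + a) % P + 1)).wired = (st ((c₀ + (a + 1)) % P)).wired := fun a => by
    rw [← (st_mod_succ ι V hadm h0 hst (Nat.mod_lt _ hP)).2, Nat.mod_add_mod, add_assoc]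
  have hsome_true : (st ((c₀ + 0) % P)).wired = true ∨ (st ((c₀ + 1) % P)).wired = true ∨
      (st ((c₀ + 2) % P)).wired = true ∨ (st ((c₀ + 3) % P)).wired = true ∨ (st ((c₀ + 3) % P + 1)).wired = true := by
    rw [← i0, ← i2, ← i3]; exact hwired
  have hsome_false : (st ((c₀ + 1) % P)).wired = false ∨ (st ((c₀ + 2) % P)).wired = false ∨
      (st ((c₀ + 3) % P)).wired = false := by
    have h := hfree _ (Nat.mod_lt _ hP) hfeq
    rw [hAB] at h
    interval_cases fpos
    · exact Or.inl h
    · exact Or.inr (Or.inl h)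
    · exact Or.inr (Or.inr h)
  have hjunc : ∃ m, m ≤ 3 ∧ (st ((c₀ + m) % P)).wired ≠ (st ((c₀ + m) % P + 1)).wired := by
    rcases bool_window_flip _ _ _ _ _ hsome_true hsome_false with h | h | h | h
    · exact ⟨0, by norm_num, by rwa [hAB]⟩
    · exact ⟨1, by norm_num, by rwa [hAB]⟩
    · exact ⟨2, by norm_num, by rwa [hAB]⟩
    · exact ⟨3, by norm_num, h⟩
  obtain ⟨m, hm3, hne⟩ := hjunc
  -- the straight strip through the window
  have hne' : ¬ ((st ((c₀ + m) % P + 1)).level = (st ((c₀ + m) % P)).level ∧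
      (st ((c₀ + m) % P + 1)).wired = (st ((c₀ + m) % P)).wired) := fun h => hne h.2.symm
  obtain ⟨z, k, hz, hzp, hzs, m0, mW, mE, mS, nN, nNW, nNE, nNN, nNNW, nNNE, mEE, mSE, nNEE, nNNEE⟩ :=
    strip_of_active ι V hadm h0 hst hFL (t := (c₀ + m) % P) (Nat.mod_lt _ hP) hne' (e := 4 + fpos - m) (by omega) (by omega)
  have hidx : ((c₀ + m) % P + 4 * P - 4 + (4 + fpos - m)) % P = (c₀ + fpos) % P := window_offset hP hm3
  have hfz : f = gapFace (z, k) := by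
    rw [hfeq, ← getElem_cycle_congr (Nat.mod_lt _ hP) (Nat.mod_lt _ hP) hidx, hz]
  have hfree' : (st (((c₀ + m) % P + 4 * P - 4 + (4 + fpos - m)) % P + 1)).wired = false :=
    hfree _ (Nat.mod_lt _ hP) (by rw [hz, hfz])
  have hcp1 : (((c₀ + m) % P + 4 * P - 4 + (4 + fpos - m - 1)) % P + 1) % P =
      ((c₀ + m) % P + 4 * P - 4 + (4 + fpos - m)) % P := by
    rw [idx_succ, show 4 + fpos - m - 1 + 1 = 4 + fpos - m by omega]
  rw [hfz] at hf ⊢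
  exact strip_pair ι V hadm h0 hst (Nat.mod_lt _ hP) hz (Nat.mod_lt _ hP) hcp1 hzp m0 mW mE mS nN nNW nNE nNN nNNW nNNE
    hfree' hzs mEE mSE nNEE nNNEE hx hxf hf

end Assembly


/-! ### The theorems -/

/-- **Lemma V (unit differences), tracked-corner form.** For the jump collar `ι.model V` of an
ADMISSIBLE leg insertion whose insertion points are flat (the domain is a discrete half-plane) to
distance `sinkLegs + 4`, on a domain `V` every boundary vertex of which has a `√8`-chart
(`V` is a discrete half-plane, quadrant or three-quarter plane on the lattice points within distance
`√8`), EVERY valid height configuration has unit height differences across every tracked corner: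
`|h x - h f| = 1` for every vertex-cell `x` and every face-cell `f` at `x`. (Validity gives this when
`x` or `f` is free; the prescribed corners are `pcc_of_charts`.) The chart hypothesis cannot be
dropped: on a lattice-connected, hole-free `V` with a width-one neck joining two boxes, the datum
`(1,1,1;3)` with the sink in one box and the sources in the other has arc vertices at level `-3`
next to collar faces at level `0` along the neck (exact evaluation, module docstring). [folklore] -/
theorem unitDifferences_tracked (V : Finset (ℤ × ℤ)) (ι : LegInsertionData) (hadm : ι.IsAdmissible V)
    (hFL : ∀ x ∈ insert ι.sink ι.source, ∃ d : ℤ × ℤ, (d = (1, 0) ∨ d = (-1, 0) ∨ d = (0, 1) ∨ d = (0, -1)) ∧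
      ∀ v : ℤ × ℤ, (v.1 - x.1) ^ 2 + (v.2 - x.2) ^ 2 ≤ ((ι.sinkLegs : ℤ) + 4) ^ 2 →
        (v ∈ V ↔ 0 ≤ (v.1 - x.1) * d.1 + (v.2 - x.2) * d.2))
    (hCH : ∀ x ∈ V, (∃ y : ℤ × ℤ, y ∉ V ∧ (y.1 - x.1) ^ 2 + (y.2 - x.2) ^ 2 = 1) →
      ∃ a d : ℤ × ℤ, (d = (1, 0) ∨ d = (-1, 0) ∨ d = (0, 1) ∨ d = (0, -1)) ∧
      ((∀ v : ℤ × ℤ, (v.1 - x.1) ^ 2 + (v.2 - x.2) ^ 2 ≤ 8 →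
          (v ∈ V ↔ 0 ≤ (v.1 - a.1) * d.1 + (v.2 - a.2) * d.2)) ∨
       (∀ v : ℤ × ℤ, (v.1 - x.1) ^ 2 + (v.2 - x.2) ^ 2 ≤ 8 →
          (v ∈ V ↔ 0 ≤ (v.1 - a.1) * d.1 + (v.2 - a.2) * d.2 ∧ 0 ≤ (v.2 - a.2) * d.1 - (v.1 - a.1) * d.2)) ∨
       (∀ v : ℤ × ℤ, (v.1 - x.1) ^ 2 + (v.2 - x.2) ^ 2 ≤ 8 →
          (v ∈ V ↔ 0 ≤ (v.1 - a.1) * d.1 + (v.2 - a.2) * d.2 ∨ 0 ≤ (v.2 - a.2) * d.1 - (v.1 - a.1) * d.2))))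
    (h : ↥(ι.model V).freeCells → ℤ) (hval : (ι.model V).IsValid h) :
    ∀ x ∈ (ι.model V).vertexCells, ∀ f ∈ SixVertex.vertexFaces x, f ∈ (ι.model V).faceCells →
      |(ι.model V).hv h x - (ι.model V).hf h f| = 1 :=
  tracked_unit_of_pcc (ι.model V) hval (pcc_of_charts ι V hadm hCH hFL)

/-- **Lemma V (unit differences), live-edge form** — the hypothesis `hunit` of the lead's BKW
factorisation: under the same hypotheses, the four corners of every live edge carry unit height
differences. [folklore] -/
theorem unitDifferences_live (V : Finset (ℤ × ℤ)) (ι : LegInsertionData) (hadm : ι.IsAdmissible V)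
    (hFL : ∀ x ∈ insert ι.sink ι.source, ∃ d : ℤ × ℤ, (d = (1, 0) ∨ d = (-1, 0) ∨ d = (0, 1) ∨ d = (0, -1)) ∧
      ∀ v : ℤ × ℤ, (v.1 - x.1) ^ 2 + (v.2 - x.2) ^ 2 ≤ ((ι.sinkLegs : ℤ) + 4) ^ 2 →
        (v ∈ V ↔ 0 ≤ (v.1 - x.1) * d.1 + (v.2 - x.2) * d.2))
    (hCH : ∀ x ∈ V, (∃ y : ℤ × ℤ, y ∉ V ∧ (y.1 - x.1) ^ 2 + (y.2 - x.2) ^ 2 = 1) →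
      ∃ a d : ℤ × ℤ, (d = (1, 0) ∨ d = (-1, 0) ∨ d = (0, 1) ∨ d = (0, -1)) ∧
      ((∀ v : ℤ × ℤ, (v.1 - x.1) ^ 2 + (v.2 - x.2) ^ 2 ≤ 8 →
          (v ∈ V ↔ 0 ≤ (v.1 - a.1) * d.1 + (v.2 - a.2) * d.2)) ∨
       (∀ v : ℤ × ℤ, (v.1 - x.1) ^ 2 + (v.2 - x.2) ^ 2 ≤ 8 →
          (v ∈ V ↔ 0 ≤ (v.1 - a.1) * d.1 + (v.2 - a.2) * d.2 ∧ 0 ≤ (v.2 - a.2) * d.1 - (v.1 - a.1) * d.2)) ∨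
       (∀ v : ℤ × ℤ, (v.1 - x.1) ^ 2 + (v.2 - x.2) ^ 2 ≤ 8 →
          (v ∈ V ↔ 0 ≤ (v.1 - a.1) * d.1 + (v.2 - a.2) * d.2 ∨ 0 ≤ (v.2 - a.2) * d.1 - (v.1 - a.1) * d.2))))
    (h : ↥(ι.model V).freeCells → ℤ) (hval : (ι.model V).IsValid h) :
    ∀ e ∈ (ι.model V).E,
      |(ι.model V).hv h e.1 - (ι.model V).hf h (SixVertex.leftFace e false)| = 1 ∧
      |(ι.model V).hv h e.1 - (ι.model V).hf h (SixVertex.leftFace e true)| = 1 ∧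
      |(ι.model V).hv h (SixVertex.edgeTip e) - (ι.model V).hf h (SixVertex.leftFace e false)| = 1 ∧
      |(ι.model V).hv h (SixVertex.edgeTip e) - (ι.model V).hf h (SixVertex.leftFace e true)| = 1 :=
  live_unit_of_tracked (ι.model V) (unitDifferences_tracked V ι hadm hFL hCH h hval)

/-! ### Registered one-line forms -/

/-- **Sub-goal `s13_unitDifferences_tracked`** (registered on stmt-CriticalPhenomena-14132): Lemma V
of the insertion dictionary D2 in the all-tracked-corners form consumed by the per-configuration
rewrite — admissible datum, insertion points flat to distance `sinkLegs + 4` (the flatness clause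
of `s16_eventually_flat` with `3 ↦ 4`), boundary charts in the form of `s16_eventually_chart`
(`7 × 7` sup-norm charts at every exterior dart), valid configuration ⇒ unit height differences at
every (vertex-cell, adjacent face-cell) corner of `ι.model V`. [folklore] -/
theorem s13_unitDifferences_tracked : ∀ (V : Finset (ℤ × ℤ)) (ι : Literature.Probability.LatticeModels.CollarLegModel.LegInsertionData), ι.IsAdmissible V → (∀ x ∈ insert ι.sink ι.source, ∃ d : ℤ × ℤ, (d = (1, 0) ∨ d = (-1, 0) ∨ d = (0, 1) ∨ d = (0, -1)) ∧ ∀ v : ℤ × ℤ, (v.1 - x.1) ^ 2 + (v.2 - x.2) ^ 2 ≤ ((ι.sinkLegs : ℤ) + 4) ^ 2 → (v ∈ V ↔ 0 ≤ (v.1 - x.1) * d.1 + (v.2 - x.2) * d.2)) → (∀ u ∈ V, ∀ k : Fin 4, u + Literature.Probability.LatticeModels.CollarLegModel.dir k ∉ V → ∃ (K : Fin 4) (c₁ c₂ : ℤ), (∀ v : ℤ × ℤ, |v.1 - u.1| ≤ 3 → |v.2 - u.2| ≤ 3 → (v ∈ V ↔ c₂ ≤ v.1 * (Literature.Probability.LatticeModels.CollarLegModel.dir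 (K + 1)).1 + v.2 * (Literature.Probability.LatticeModels.CollarLegModel.dir (K + 1)).2)) ∨ (∀ v : ℤ × ℤ, |v.1 - u.1| ≤ 3 → |v.2 - u.2| ≤ 3 → (v ∈ V ↔ c₁ ≤ v.1 * (Literature.Probability.LatticeModels.CollarLegModel.dir K).1 + v.2 * (Literature.Probability.LatticeModels.CollarLegModel.dir K).2 ∧ c₂ ≤ v.1 * (Literature.Probability.LatticeModels.CollarLegModel.dir (K + 1)).1 + v.2 * (Literature.Probability.LatticeModels.CollarLegModel.dir (K + 1)).2)) ∨ (∀ v : ℤ × ℤ, |v.1 - u.1| ≤ 3 → |v.2 - u.2| ≤ 3 → (v ∈ V ↔ c₂ ≤ v.1 * (Literature.Probability.LatticeModels.CollarLegModel.dir (K + 1)).1 + v.2 * (Literature.Probability.LatticeModels.CollarLegModel.dir (K + 1)).2 ∨ v.1 * (Literature.Probability.LatticeModels.CollarLegModel.dir K).1 + v.2 * (Literature.Probability.LatticeModels.CollarLegModel.dir K).2 ≤ c₁))) → ∀ h : ↥(ι.model V).freeCells → ℤ, (ι.model V).IsValid h → ∀ x ∈ (ι.model V).vertexCells, ∀ f ∈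 Literature.Probability.LatticeModels.SixVertex.vertexFaces x, f ∈ (ι.model V).faceCells → |(ι.model V).hv h x - (ι.model V).hf h f| = 1 :=
  fun V ι hadm hFL hCH h hval => unitDifferences_tracked V ι hadm hFL (chart8_of_chart3 hCH) h hval

/-- **Sub-goal `s13_unitDifferences`** (registered on stmt-CriticalPhenomena-14132): Lemma V in the
live-edge form of the brief (hypothesis `hunit` of the BKW factorisation) — same hypotheses ⇒ the
four corners of every live edge of `ι.model V` carry unit height differences. [folklore] -/
theorem s13_unitDifferences : ∀ (V : Finset (ℤ × ℤ)) (ι : Literature.Probability.LatticeModels.CollarLegModel.LegInsertionData), ι.IsAdmissible V → (∀ x ∈ insert ι.sink ι.source, ∃ d : ℤ × ℤ, (d = (1, 0) ∨ d = (-1, 0) ∨ d = (0, 1) ∨ d = (0, -1)) ∧ ∀ v : ℤ × ℤ, (v.1 - x.1) ^ 2 + (v.2 - x.2) ^ 2 ≤ ((ι.sinkLegs : ℤ) + 4) ^ 2 → (v ∈ V ↔ 0 ≤ (v.1 - x.1) * d.1 + (v.2 - x.2) * d.2)) → (∀ u ∈ V, ∀ k : Fin 4, u + Literature.Probability.LatticeModels.CollarLegModel.dir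 k ∉ V → ∃ (K : Fin 4) (c₁ c₂ : ℤ), (∀ v : ℤ × ℤ, |v.1 - u.1| ≤ 3 → |v.2 - u.2| ≤ 3 → (v ∈ V ↔ c₂ ≤ v.1 * (Literature.Probability.LatticeModels.CollarLegModel.dir (K + 1)).1 + v.2 * (Literature.Probability.LatticeModels.CollarLegModel.dir (K + 1)).2)) ∨ (∀ v : ℤ × ℤ, |v.1 - u.1| ≤ 3 → |v.2 - u.2| ≤ 3 → (v ∈ V ↔ c₁ ≤ v.1 * (Literature.Probability.LatticeModels.CollarLegModel.dir K).1 + v.2 * (Literature.Probability.LatticeModels.CollarLegModel.dir K).2 ∧ c₂ ≤ v.1 * (Literature.Probability.LatticeModels.CollarLegModel.dir (K + 1)).1 + v.2 * (Literature.Probability.LatticeModels.CollarLegModel.dir (K + 1)).2)) ∨ (∀ v : ℤ × ℤ, |v.1 - u.1| ≤ 3 → |v.2 - u.2| ≤ 3 → (v ∈ V ↔ c₂ ≤ v.1 * (Literature.Probability.LatticeModels.CollarLegModel.dir (K + 1)).1 + v.2 * (Literature.Probability.LatticeModels.CollarLegModel.dir (K + 1)).2 ∨ v.1 * (Literature.Probability.LatticeModels.CollarLegModel.dir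 K).1 + v.2 * (Literature.Probability.LatticeModels.CollarLegModel.dir K).2 ≤ c₁))) → ∀ h : ↥(ι.model V).freeCells → ℤ, (ι.model V).IsValid h → ∀ e ∈ (ι.model V).E, |(ι.model V).hv h e.1 - (ι.model V).hf h (Literature.Probability.LatticeModels.SixVertex.leftFace e false)| = 1 ∧ |(ι.model V).hv h e.1 - (ι.model V).hf h (Literature.Probability.LatticeModels.SixVertex.leftFace e true)| = 1 ∧ |(ι.model V).hv h (Literature.Probability.LatticeModels.SixVertex.edgeTip e) - (ι.model V).hf h (Literature.Probability.LatticeModels.SixVertex.leftFace e false)| = 1 ∧ |(ι.model V).hv h (Literature.Probability.LatticeModels.SixVertex.edgeTip e) - (ι.model V).hf h (Literature.Probability.LatticeModels.SixVertex.leftFace e true)| = 1 :=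
  fun V ι hadm hFL hCH h hval => unitDifferences_live V ι hadm hFL (chart8_of_chart3 hCH) h hval

end Summit.CriticalPhenomena.CardyFormulaZ2.Cruxes.BoundaryDefectGaussianR.RainbowMonomialsInExcursionKernels
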